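import Literature.MathematicalPhysics.QuantumFieldTheory.BalabanImbrieJaffe1984to88.BIJ88ObservableFactorization312
import Literature.MathematicalPhysics.QuantumFieldTheory.BalabanImbrieJaffe1984to88.BIJ88Expansion5143Ordered

/-!
# `BalabanImbrieJaffe1984to88.BIJ88Expansion5143Obs` — T. Bałaban, J. Imbrie, A. Jaffe, *Effective action and cluster properties of the abelian
Higgs model*, Commun. Math. Phys. **114** (1988) 257–315 [BalabanImbrieJaffe1988]: Sect. 5.14, pp. 309–312 [PDF 53–56] — **the prime-dropped
expansion (5.14.3) IS an observable-carrying polymer gas**, so that the second display of p. 312 (`BIJ88ObservableFactorization312.obsRatio_eq_sum_prod_Gk`)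
applies to the corner expectations `⟨Π_{j∈K}(d/dt)_{γ_j} …⟩₁` of (5.14.3) VERBATIM: *"the polymer expansion u = 1 + a permits us to factor out the
normalization … ⟨Π_{σ₁} F^{m̄}_{k,loc}(X_{σ₁})⟩₁ = Σ_{{X_{r′}}} Π_{r′} G_k(X_{r′}) … The X_{r′} are disjoint, and each one covers at least one X_{σ₁}"*.

HONEST FRAMING (cell `lit-balaban`, verbatim): statement-level skeleton of published theorems with citation tags; proofs where landed; nothing here is a claim about the Yang–Mills mass gap.

PDF held: `paper:balaban1988-cmp114-bij-abelian-higgs-effective-action` (journal page = PDF page + 256); p. 309 = PDF p. 53, p. 312 = PDF p. 56.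

CITATION HEADER (verbatim).  p. 309 [PDF 53]: *"the above expansion holds again, but without the condition that {X_β} fill Λ^{(k)}_{12}. The {X_β}
must cover all cubes connected with the (d/dt)_{γ_j}, j ∈ H. Let us drop the prime"*; p. 312 [PDF 56]: *"Finally the polymer expansion u = 1 + a
permits us to factor out the normalization. Without going into details, it is clear that the result can be written in the following form:
⟨Π_{σ₁} F^{m̄}_{k,loc}(X_{σ₁})⟩₁ = Σ_{{X_{r′}}} Π_{r′} G_k(X_{r′}) Π_{c: X_c⊄∪_{r′}X_{r′}} F^L_{k+1,loc}(X_c). The X_{r′} are disjoint, and each one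
covers at least one X_{σ₁}, the support of one of the observables F^{m̄}_{k,loc}."*

WHAT IS REPRODUCED (unit `lit-balaban-p25`, generation 11 of the Phase-2 proof seat p25; SKELETON rows `C2.Eq5.14.3-5.14.4` (link) and
`C2.Claim@312` (second display); HOME `run/shared/lean/pub/lit-balaban/lit-balaban-p25/`).  The instantiation of the abstract decorated gas of
`BIJ88ObservableGas312`/`BIJ88ObservableFactorization312` by the data of this seat's gen-10 `BIJ88Expansion5143` (the prime-dropped (5.14.3),
`expansion5143_dropPrime`) and `BIJ88Expansion5143Ordered` (the cluster-configuration incompatibility `cinc`, the virtual supports `cvsupp` of gen 9):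
* §1 the data: observable-carrying polymers `obsPolys W loc K` (the nonempty `X ⊆ W` with `H(X) = slotsIn loc K X ≠ ∅`), the incompatibility
  `Ov (cvsupp adj W)` (overlap of virtual supports = `cinc` on the polymers of `W`, `ov_cvsupp_iff`) with its `Std.Refl`/`Std.Symm` instances, the slot
  supports `locv1 loc j = {inl (loc j)}`;
* §2 **`sum_covering_eq_obsNumerator`**: for ANY slot-labelled activity `g(H, X)`, the prime-dropped covering expansion
  `Σ_{F nonoverlapping admissible covering K} Π_{X∈F} g(H(X), X)` equals the decorated-gas numerator `obsNumerator` of `BIJ88ObservableGas312` with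
  decorated activities `g(H(X), X)` on `obsPolys`, vacuum activities `g(∅, X)` on `polysOf W`, admissible decorated families `decFamilies` — the
  bijection `F ↦ (F ∩ obsPolys, F ∖ obsPolys)`; at `K = ∅` it is the vacuum partition function (`sum_covering_empty_eq_Z`);
* §3 for slot-local cluster-factorizing corner data `z` (gen 10): **`corner_eq_obsNumerator`** (`z K W W = obsNumerator …`), **`corner_empty_eq_Z`**
  (`z ∅ W W = Z`), and — in a Kotecký–Preiss volume for the vacuum activities `g₃′(∅, ·)` — **`corner_ratio_eq_sum_prod_Gk`**: THE SECOND DISPLAY OF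
  p. 312 for the normalized corner expectation, `z K W W / z ∅ W W = Σ_{ρ disjoint, covering the slots, each member covering a slot} Π_{X′∈ρ} G_k(X′)`
  with the `G_k` DEFINED in `BIJ88ObservableFactorization312.Gk`; `corner_empty_ne_zero`.
HONEST SCOPE / READINGS: (a) as in `BIJ88ObservableFactorization312`: the identity is for the expectation with ALL slots of `K` inserted (the
remainder expectation of the first display of p. 312 after the p. 311 integration by parts; the factors F^L_{k+1,loc}(X_c) are constants, not
modelled); (b) the KP hypothesis `IsKPVolume (Ov (cvsupp adj W)) (g₃′(∅,·)) a (polysOf W)` is the printed *"standard exercise … using (5.14.4)"* (p. 310)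
and is NOT proved here ((5.14.4) is the typed leaf `BIJ88Sect5StatementsPart2.Ineq5144`); (c) no bound on `G_k` (`BIJ88Sect5StatementsPart4.Ineq312`)
is asserted; finite identities, 0 `sorry`, 0 new `Prop` facts (D-0026); imports `BIJ88ObservableFactorization312`, `BIJ88Expansion5143Ordered` only.
-/

noncomputable section

open Finset
open Literature.Probability.LatticeModels
open Literature.MathematicalPhysics.QuantumFieldTheory.BalabanImbrieJaffe1984to88.BIJ88Clusters5134 (IsClusterFactorizing)
open Literature.MathematicalPhysics.QuantumFieldTheory.BalabanImbrieJaffe1984to88.BIJ88PolymerRep5134 (IsAdmissible)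
open Literature.MathematicalPhysics.QuantumFieldTheory.BalabanImbrieJaffe1984to88.BIJ88VirtualSupports310
open Literature.MathematicalPhysics.QuantumFieldTheory.BalabanImbrieJaffe1984to88.BIJ88Expansion5143
open Literature.MathematicalPhysics.QuantumFieldTheory.BalabanImbrieJaffe1984to88.BIJ88Expansion5143Ordered
open Literature.MathematicalPhysics.QuantumFieldTheory.BalabanImbrieJaffe1984to88.BIJ88ObservableGas312
open Literature.MathematicalPhysics.QuantumFieldTheory.BalabanImbrieJaffe1984to88.BIJ88SupportRegrouping312
open Literature.MathematicalPhysics.QuantumFieldTheory.BalabanImbrieJaffe1984to88.BIJ88ObservableFactorization312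

namespace Literature.MathematicalPhysics.QuantumFieldTheory.BalabanImbrieJaffe1984to88.BIJ88Expansion5143Obs

variable {ι : Type*} [DecidableEq ι] {S : Type*} [DecidableEq S]

/-! ## §1 The data of the observable-carrying gas of (5.14.3) -/

section Data

variable (adj : ι → ι → Prop) [DecidableRel adj] (W : Finset ι) (loc : S → ι) (K : Finset S)

/-- **the observable-carrying polymers** (p. 309: the `X_β` with `H_β ≠ ∅`; p. 312: the polymers covering an observable support `X_{σ₁}`): the nonempty
`X ⊆ W` in which some slot of `K` is located. [cite: BalabanImbrieJaffe1988, (5.14.3) p.309] -/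
def obsPolys : Finset (Finset ι) := (polysOf W).filter fun X => (slotsIn loc K X).Nonempty

/-- the support of the slot `j` among the virtual cubes: the one cube `inl (loc j)`. [cite: BalabanImbrieJaffe1988, p.310 (Sect. 5.14)] -/
def locv1 : S → Finset (ι ⊕ (Finset ι × Finset ι)) := fun j => {locv loc j}

/-- overlap of virtual supports is reflexive (every virtual support contains its diagonal pair). [cite: BalabanImbrieJaffe1988, p.310 (Sect. 5.14)] -/
instance instReflOvCvsupp : Std.Refl (Ov (cvsupp adj W)) :=
  ⟨fun X h => disjoint_left.1 h (inr_self_mem_vsupp X) (inr_self_mem_vsupp X)⟩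

/-- overlap of virtual supports is symmetric. [cite: BalabanImbrieJaffe1988, p.310 (Sect. 5.14)] -/
instance instSymmOvCvsupp : Std.Symm (Ov (cvsupp adj W)) := ⟨ov_symm⟩

variable {adj W loc K}

omit [DecidableEq S] in
/-- membership in `obsPolys`. [cite: BalabanImbrieJaffe1988, (5.14.3) p.309] -/
theorem mem_obsPolys {X : Finset ι} : X ∈ obsPolys W loc K ↔ X ∈ polysOf W ∧ (slotsIn loc K X).Nonempty := mem_filter

omit [DecidableEq ι] [DecidableEq S] in
/-- membership in `polysOf`. [cite: BalabanImbrieJaffe1988, (5.14.3) p.309] -/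
theorem mem_polysOf {X : Finset ι} : X ∈ polysOf W ↔ X ⊆ W ∧ X.Nonempty := by
  unfold polysOf; rw [mem_filter, mem_powerset]

/-- on the polymers of `W`, overlap of virtual supports is the cluster-configuration incompatibility `cinc`. [cite: BalabanImbrieJaffe1988, p.310 (Sect. 5.14)] -/
theorem ov_cvsupp_iff {X Y : Finset ι} (hX : X ∈ polysOf W) (hY : Y ∈ polysOf W) : Ov (cvsupp adj W) X Y ↔ cinc adj X Y := by
  unfold Ov
  rw [← not_iff_not, not_not, disjoint_vsupp_iff hX hY]

omit [DecidableEq S] in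
/-- the slot support lies inside the virtual support of a polymer iff the slot is located in the polymer. [cite: BalabanImbrieJaffe1988, p.310 (Sect. 5.14)] -/
theorem locv1_subset_iff {j : S} {X : Finset ι} : locv1 loc j ⊆ cvsupp adj W X ↔ loc j ∈ X := by
  unfold locv1 locv
  rw [singleton_subset_iff, inl_mem_vsupp_iff]
  exact Iff.rfl

omit [DecidableEq S] in
/-- no slots located in a polymer: `H(X) = ∅`. [cite: BalabanImbrieJaffe1988, (5.14.3) p.309] -/
theorem slotsIn_eq_empty_iff {X : Finset ι} : slotsIn loc K X = ∅ ↔ ∀ j ∈ K, loc j ∉ X := by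
  rw [eq_empty_iff_forall_notMem]
  exact ⟨fun h j hj hjX => h j (mem_slotsIn.2 ⟨hj, hjX⟩), fun h j hj => h j (mem_slotsIn.1 hj).1 (mem_slotsIn.1 hj).2⟩

omit [DecidableEq S] in
/-- with no slots at all every `H(X)` is empty. [cite: BalabanImbrieJaffe1988, (5.14.3) p.309] -/
theorem slotsIn_empty (X : Finset ι) : slotsIn loc (∅ : Finset S) X = ∅ := slotsIn_eq_empty_iff.2 fun _ h => absurd h (notMem_empty _)

omit [DecidableEq S] in
/-- with no slots there are no observable-carrying polymers. [cite: BalabanImbrieJaffe1988, (5.14.3) p.309] -/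
theorem obsPolys_empty : obsPolys W loc (∅ : Finset S) = ∅ := by
  refine eq_empty_iff_forall_notMem.2 fun X hX => ?_
  have h := (mem_obsPolys.1 hX).2
  rw [slotsIn_empty] at h
  exact not_nonempty_empty h

/-- with no slots the only admissible decorated family is the empty one. [cite: BalabanImbrieJaffe1988, (5.14.3) p.309] -/
theorem decFamilies_empty :
    decFamilies (cvsupp adj W) (slotsIn loc (∅ : Finset S)) ∅ (obsPolys W loc ∅) = {∅} := by
  rw [obsPolys_empty]
  ext D
  rw [mem_decFamilies, mem_singleton]
  constructor
  · rintro ⟨hD, -, -⟩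
    exact subset_empty.1 hD
  · rintro rfl
    exact ⟨subset_rfl, fun _ h => absurd h (notMem_empty _), biUnion_empty⟩

end Data

/-! ## §2 The prime-dropped covering expansion is the decorated-gas numerator -/

section Numerator

variable {adj : ι → ι → Prop} [DecidableRel adj] {W : Finset ι} {loc : S → ι} {K : Finset S}

/-- the vacuum members of a covering family carry no slot: if `D` carries every slot of `K` and `Y` is compatible with `D`, then `H(Y) = ∅`.
[cite: BalabanImbrieJaffe1988, (5.14.3) p.309] -/
theorem slotsIn_eq_empty_of_compatible {D : Finset (Finset ι)} (hD : D ∈ decFamilies (cvsupp adj W) (slotsIn loc K) K (obsPolys W loc K))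
    {Y : Finset ι} (hY : Y ∈ polysOf W) (hDY : ∀ X ∈ D, ¬ Ov (cvsupp adj W) X Y) : slotsIn loc K Y = ∅ := by
  obtain ⟨hDsub, -, hcov⟩ := mem_decFamilies.1 hD
  refine slotsIn_eq_empty_iff.2 fun j hj hjY => ?_
  rw [← hcov] at hj
  obtain ⟨X, hX, hjX⟩ := mem_biUnion.1 hj
  have hXp : X ∈ polysOf W := (mem_obsPolys.1 (hDsub hX)).1
  exact hDY X hX ((ov_cvsupp_iff hXp hY).2 (cinc_of_not_disjoint X Y fun h => disjoint_left.1 h (mem_slotsIn.1 hjX).2 hjY))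

/-- the decorated-gas numerator as one sum over the admissible pairs `(D, A)`. [cite: BalabanImbrieJaffe1988, (5.14.5) p.312] -/
private theorem obsNumerator_eq_sum_filter_product {P Q : Type*} [DecidableEq P] (inc : P → P → Prop) [DecidableRel inc]
    (incQ : Q → P → Prop) [∀ X Y, Decidable (incQ X Y)] (𝒟 : Finset (Finset Q)) (wQ : Q → ℂ) (w : P → ℂ) (Λ : Finset P) :
    obsNumerator inc incQ 𝒟 wQ w Λ =
      ∑ x ∈ (𝒟 ×ˢ Λ.powerset).filter (fun x => IsCompatible inc x.2 ∧ ∀ X ∈ x.1, ∀ Y ∈ x.2, ¬ incQ X Y),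
        (∏ X ∈ x.1, wQ X) * ∏ Y ∈ x.2, w Y := by
  unfold obsNumerator
  rw [sum_filter, sum_product]

/-- **THE PRIME-DROPPED (5.14.3) IS A DECORATED-GAS NUMERATOR**: for any slot-labelled activity `g(H, X)`,
`Σ_{F nonoverlapping admissible, covering K} Π_{X∈F} g(H(X), X) = obsNumerator` of the gas with decorated polymers `obsPolys W loc K` (activities
`g(H(X), X)`), vacuum polymers `polysOf W` (activities `g(∅, X)`), incompatibility = overlap of virtual supports, admissible decorated families
`decFamilies` (pairwise compatible, carrying every slot) — the splitting `F = (F ∩ obsPolys) ⊔ (F ∖ obsPolys)` (p. 312: *"the polymer expansion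
u = 1 + a"* — the vacuum polymers form the gas whose normalization is factored out). [cite: BalabanImbrieJaffe1988, (5.14.3) p.309, p.312] -/
theorem sum_covering_eq_obsNumerator (g : Finset S → Finset ι → ℂ) :
    ∑ F ∈ (nonoverlapping W).filter (fun F => IsAdmissible adj F ∧ Covers loc K F), ∏ X ∈ F, g (slotsIn loc K X) X =
      obsNumerator (Ov (cvsupp adj W)) (Ov (cvsupp adj W)) (decFamilies (cvsupp adj W) (slotsIn loc K) K (obsPolys W loc K))
        (fun X => g (slotsIn loc K X) X) (fun X => g ∅ X) (polysOf W) := by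
  classical
  set q : Finset ι → Prop := fun X => (slotsIn loc K X).Nonempty with hq
  rw [obsNumerator_eq_sum_filter_product]
  refine sum_nbij' (fun F => (F.filter q, F.filter fun X => ¬ q X)) (fun x => x.1 ∪ x.2) ?_ ?_ ?_ ?_ ?_
  · -- families ↦ admissible pairs
    intro F hF
    simp only [mem_filter] at hF
    obtain ⟨hFno, hadm, hcov⟩ := hF
    obtain ⟨hFW, hFd⟩ := mem_nonoverlapping.1 hFno
    have hFp : ∀ X ∈ F, X ∈ polysOf W := fun X hX => mem_polysOf.2 (hFW X hX)
    have hnc : ∀ X ∈ F, ∀ Y ∈ F, X ≠ Y → ¬ cinc adj X Y := (pairwise_not_cinc_iff F).2 ⟨hFd, hadm⟩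
    have hnov : ∀ X ∈ F, ∀ Y ∈ F, X ≠ Y → ¬ Ov (cvsupp adj W) X Y := fun X hX Y hY hne h =>
      hnc X hX Y hY hne ((ov_cvsupp_iff (hFp X hX) (hFp Y hY)).1 h)
    refine mem_filter.2 ⟨mem_product.2 ⟨mem_decFamilies.2 ⟨fun X hX => mem_obsPolys.2 ⟨hFp X (mem_filter.1 hX).1, (mem_filter.1 hX).2⟩,
      fun X hX X' hX' hne => ?_, ?_⟩, mem_powerset.2 fun Y hY => hFp Y (mem_filter.1 hY).1⟩,
      fun Y hY Y' hY' hne => hnov Y (mem_filter.1 (mem_coe.1 hY)).1 Y' (mem_filter.1 (mem_coe.1 hY')).1 hne,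
      fun X hX Y hY => hnov X (mem_filter.1 hX).1 Y (mem_filter.1 hY).1 fun he => (mem_filter.1 hY).2 (he ▸ (mem_filter.1 hX).2)⟩
    · have h := hnov X (mem_filter.1 hX).1 X' (mem_filter.1 hX').1 hne
      unfold Ov at h
      rwa [not_not] at h
    · refine Subset.antisymm (biUnion_subset.2 fun X _ => slotsIn_subset X) fun j hj => ?_
      obtain ⟨X, hX, hjX⟩ := hcov j hj
      have hjs : j ∈ slotsIn loc K X := mem_slotsIn.2 ⟨hj, hjX⟩
      exact mem_biUnion.2 ⟨X, mem_filter.2 ⟨hX, ⟨j, hjs⟩⟩, hjs⟩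
  · -- admissible pairs ↦ families
    rintro ⟨D, A⟩ hx
    simp only [mem_filter, mem_product, mem_powerset] at hx
    obtain ⟨⟨hD, hA⟩, hAc, hDA⟩ := hx
    obtain ⟨hDsub, hDd, hcov⟩ := mem_decFamilies.1 hD
    have hDp : ∀ X ∈ D, X ∈ polysOf W := fun X hX => (mem_obsPolys.1 (hDsub hX)).1
    have hAp : ∀ Y ∈ A, Y ∈ polysOf W := fun Y hY => hA hY
    have hnov : ∀ X ∈ D ∪ A, ∀ Y ∈ D ∪ A, X ≠ Y → ¬ Ov (cvsupp adj W) X Y := by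
      intro X hX Y hY hne
      rcases mem_union.1 hX with hX | hX <;> rcases mem_union.1 hY with hY | hY
      · intro h; exact h (hDd X hX Y hY hne)
      · exact hDA X hX Y hY
      · exact fun h => hDA Y hY X hX (ov_symm X Y h)
      · exact hAc (mem_coe.2 hX) (mem_coe.2 hY) hne
    have hnc : ∀ X ∈ D ∪ A, ∀ Y ∈ D ∪ A, X ≠ Y → ¬ cinc adj X Y := by
      intro X hX Y hY hne h
      have hXp : X ∈ polysOf W := by rcases mem_union.1 hX with hX | hX; exacts [hDp X hX, hAp X hX]
      have hYp : Y ∈ polysOf W := by rcases mem_union.1 hY with hY | hY; exacts [hDp Y hY, hAp Y hY]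
      exact hnov X hX Y hY hne ((ov_cvsupp_iff hXp hYp).2 h)
    obtain ⟨hd, hadm⟩ := (pairwise_not_cinc_iff (D ∪ A)).1 hnc
    simp only [mem_filter, mem_nonoverlapping]
    refine ⟨⟨fun X hX => mem_polysOf.1 ?_, hd⟩, hadm, fun j hj => ?_⟩
    · rcases mem_union.1 hX with hX | hX; exacts [hDp X hX, hAp X hX]
    · rw [← hcov] at hj
      obtain ⟨X, hX, hjX⟩ := mem_biUnion.1 hj
      exact ⟨X, mem_union_left A hX, (mem_slotsIn.1 hjX).2⟩
  · -- left inverse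
    intro F _
    exact filter_union_filter_not_eq q F
  · -- right inverse
    rintro ⟨D, A⟩ hx
    simp only [mem_filter, mem_product, mem_powerset] at hx
    obtain ⟨⟨hD, hA⟩, -, hDA⟩ := hx
    have hqD : ∀ X ∈ D, q X := fun X hX => (mem_obsPolys.1 ((mem_decFamilies.1 hD).1 hX)).2
    have hqA : ∀ Y ∈ A, ¬ q Y := fun Y hY h => by
      have he := slotsIn_eq_empty_of_compatible hD (hA hY) fun X hX => hDA X hX Y hY
      rw [hq] at h; rw [he] at h; exact not_nonempty_empty h
    show (filter q (D ∪ A), filter (fun X => ¬ q X) (D ∪ A)) = (D, A)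
    rw [filter_union, filter_union, filter_true_of_mem hqD, filter_false_of_mem hqA, union_empty,
      filter_false_of_mem (fun X hX => not_not.2 (hqD X hX)), filter_true_of_mem hqA, empty_union]
  · -- weights
    intro F _
    rw [← prod_filter_mul_prod_filter_not F q]
    refine congrArg _ (prod_congr rfl fun Y hY => ?_)
    rw [not_nonempty_iff_eq_empty.1 (mem_filter.1 hY).2]

/-- at `K = ∅` (no observables) the covering expansion is the vacuum partition function `Z(Λ)` of the gas (the normalization ⟨…⟩₁ of p. 312).
[cite: BalabanImbrieJaffe1988, (5.13.4) p.306, p.312] -/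
theorem sum_covering_empty_eq_Z (g : Finset S → Finset ι → ℂ) :
    ∑ F ∈ (nonoverlapping W).filter (fun F => IsAdmissible adj F ∧ Covers loc (∅ : Finset S) F), ∏ X ∈ F, g (slotsIn loc ∅ X) X =
      polymerPartitionFunction (Ov (cvsupp adj W)) (fun X => g ∅ X) (polysOf W) := by
  rw [sum_covering_eq_obsNumerator, decFamilies_empty, obsNumerator_singleton_empty]

end Numerator

/-! ## §3 The corner expectations of (5.14.3): numerator, normalization, and the second display of p. 312 -/

section Corner

variable {adj : ι → ι → Prop} [DecidableRel adj] {loc : S → ι} {z : Finset S → Finset ι → Finset ι → ℂ} {K : Finset S} {W : Finset ι}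

/-- **`⟨Π_{j∈K}(d/dt)_{γ_j} Π_{i∈W} f(□_i)⟩` IS THE DECORATED-GAS NUMERATOR**: for slot-local corner data cluster-factorizing for the slot set `K`,
`z K W W = obsNumerator` of the gas of §2 with the prime-dropped activities `g₃′(H(X), X)` / `g₃′(∅, X)` (by `expansion5143_dropPrime`).
[cite: BalabanImbrieJaffe1988, (5.14.3) p.309, p.312] -/
theorem corner_eq_obsNumerator (hz : IsClusterFactorizing adj (z K)) (hloc : IsSlotLocal loc z) (hK : ∀ j ∈ K, loc j ∈ W) :
    z K W W = obsNumerator (Ov (cvsupp adj W)) (Ov (cvsupp adj W)) (decFamilies (cvsupp adj W) (slotsIn loc K) K (obsPolys W loc K))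
      (fun X => prime (g3 adj z) (slotsIn loc K X) X) (fun X => prime (g3 adj z) ∅ X) (polysOf W) := by
  rw [expansion5143_dropPrime hz hloc hK, sum_covering_eq_obsNumerator]

/-- **the normalization `⟨Π_{i∈W} f(□_i)⟩` IS THE VACUUM PARTITION FUNCTION** of the gas with activities `g₃′(∅, X)`.
[cite: BalabanImbrieJaffe1988, (5.13.4) p.306, p.312] -/
theorem corner_empty_eq_Z (hz : IsClusterFactorizing adj (z ∅)) (hloc : IsSlotLocal loc z) (W : Finset ι) :
    z ∅ W W = polymerPartitionFunction (Ov (cvsupp adj W)) (fun X => prime (g3 adj z) ∅ X) (polysOf W) := by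
  rw [expansion5143_dropPrime hz hloc (fun _ h => absurd h (notMem_empty _)), sum_covering_empty_eq_Z]

/-- in a Kotecký–Preiss volume the normalization does not vanish. [cite: BalabanImbrieJaffe1988, p.310, p.312 (Sect. 5.14)] -/
theorem corner_empty_ne_zero (hz : IsClusterFactorizing adj (z ∅)) (hloc : IsSlotLocal loc z) {a : Finset ι → ℝ}
    (hKP : IsKPVolume (Ov (cvsupp adj W)) (fun X => prime (g3 adj z) ∅ X) a (polysOf W)) : z ∅ W W ≠ 0 := by
  rw [corner_empty_eq_Z hz hloc W]
  exact vacuumZ_ne_zero hKP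

omit [DecidableEq S] in
/-- the covering convention of `BIJ88ObservableFactorization312` holds for the slots: a slot carried by `X` lies in `K` and its support inside the
virtual support of `X`. [cite: BalabanImbrieJaffe1988, p.309 (Sect. 5.14)] -/
theorem obsPolys_hobs : ∀ X ∈ obsPolys W loc K, ∀ j ∈ slotsIn loc K X, j ∈ K ∧ locv1 loc j ⊆ cvsupp adj W X :=
  fun _ _ _ hj => ⟨(mem_slotsIn.1 hj).1, locv1_subset_iff.2 (mem_slotsIn.1 hj).2⟩

/-- **THE SECOND DISPLAY OF p. 312 FOR THE CORNER EXPECTATIONS OF (5.14.3)** (*"the polymer expansion u = 1 + a permits us to factor out the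
normalization … = Σ_{{X_{r′}}} Π_{r′} G_k(X_{r′}) … The X_{r′} are disjoint, and each one covers at least one X_{σ₁}"*): for slot-local corner data,
cluster-factorizing for `K` and for `∅`, in a Kotecký–Preiss volume for the vacuum activities `g₃′(∅, ·)`, the normalized expectation
`⟨Π_{j∈K}(d/dt)_{γ_j} …⟩ / ⟨…⟩` is the sum over the families `ρ` of PAIRWISE DISJOINT sets of (virtual) cubes covering the slot supports, each member
covering at least one slot, of `Π_{X′∈ρ} G_k(X′)` with the locally defined `G_k` of `BIJ88ObservableFactorization312.Gk`.
[cite: BalabanImbrieJaffe1988, p.312 (Sect. 5.14)] -/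
theorem corner_ratio_eq_sum_prod_Gk (hzK : IsClusterFactorizing adj (z K)) (hz0 : IsClusterFactorizing adj (z ∅)) (hloc : IsSlotLocal loc z)
    (hK : ∀ j ∈ K, loc j ∈ W) {a : Finset ι → ℝ} (hKP : IsKPVolume (Ov (cvsupp adj W)) (fun X => prime (g3 adj z) ∅ X) a (polysOf W)) :
    z K W W / z ∅ W W =
      ∑ ρ ∈ disjFamilies (asupp (isuppO (cvsupp adj W)) (itemU (cvsupp adj W) (obsPolys W loc K) (polysOf W))) with
          (Cov (locv1 loc) K ρ ∧ ∀ X' ∈ ρ, ∃ j ∈ K, locv1 loc j ⊆ X'),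
        ∏ X' ∈ ρ, Gk (cvsupp adj W) (cvsupp adj W) (slotsIn loc K) (locv1 loc) K (obsPolys W loc K)
          (fun X => prime (g3 adj z) (slotsIn loc K X) X) (Ov (cvsupp adj W)) (fun X => prime (g3 adj z) ∅ X) (polysOf W) X' := by
  rw [corner_eq_obsNumerator hzK hloc hK, corner_empty_eq_Z hz0 hloc W]
  exact obsRatio_eq_sum_covering_prod_Gk (fun _ _ => Iff.rfl) obsPolys_hobs (fun X hX => (mem_obsPolys.1 hX).2)
    (fun j _ => singleton_nonempty _) _ hKP

/-- the same with only the covering condition on `ρ` (the members covering no slot contribute `G_k = 0`, `BIJ88ObservableFactorization312.Gk_covers`).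
[cite: BalabanImbrieJaffe1988, p.312 (Sect. 5.14)] -/
theorem corner_ratio_eq_sum_cov_prod_Gk (hzK : IsClusterFactorizing adj (z K)) (hz0 : IsClusterFactorizing adj (z ∅)) (hloc : IsSlotLocal loc z)
    (hK : ∀ j ∈ K, loc j ∈ W) {a : Finset ι → ℝ} (hKP : IsKPVolume (Ov (cvsupp adj W)) (fun X => prime (g3 adj z) ∅ X) a (polysOf W)) :
    z K W W / z ∅ W W =
      ∑ ρ ∈ disjFamilies (asupp (isuppO (cvsupp adj W)) (itemU (cvsupp adj W) (obsPolys W loc K) (polysOf W))) with Cov (locv1 loc) K ρ,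
        ∏ X' ∈ ρ, Gk (cvsupp adj W) (cvsupp adj W) (slotsIn loc K) (locv1 loc) K (obsPolys W loc K)
          (fun X => prime (g3 adj z) (slotsIn loc K X) X) (Ov (cvsupp adj W)) (fun X => prime (g3 adj z) ∅ X) (polysOf W) X' := by
  rw [corner_eq_obsNumerator hzK hloc hK, corner_empty_eq_Z hz0 hloc W]
  exact obsRatio_eq_sum_prod_Gk (fun _ _ => Iff.rfl) obsPolys_hobs (fun X hX => (mem_obsPolys.1 hX).2)
    (fun j _ => singleton_nonempty _) _ hKP

/-- hence the un-normalized form: `z K W W = z ∅ W W · Σ_ρ Π G_k`. [cite: BalabanImbrieJaffe1988, p.312 (Sect. 5.14)] -/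
theorem corner_eq_Z_mul_sum_prod_Gk (hzK : IsClusterFactorizing adj (z K)) (hz0 : IsClusterFactorizing adj (z ∅)) (hloc : IsSlotLocal loc z)
    (hK : ∀ j ∈ K, loc j ∈ W) {a : Finset ι → ℝ} (hKP : IsKPVolume (Ov (cvsupp adj W)) (fun X => prime (g3 adj z) ∅ X) a (polysOf W)) :
    z K W W = z ∅ W W *
      ∑ ρ ∈ disjFamilies (asupp (isuppO (cvsupp adj W)) (itemU (cvsupp adj W) (obsPolys W loc K) (polysOf W))) with
          (Cov (locv1 loc) K ρ ∧ ∀ X' ∈ ρ, ∃ j ∈ K, locv1 loc j ⊆ X'),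
        ∏ X' ∈ ρ, Gk (cvsupp adj W) (cvsupp adj W) (slotsIn loc K) (locv1 loc) K (obsPolys W loc K)
          (fun X => prime (g3 adj z) (slotsIn loc K X) X) (Ov (cvsupp adj W)) (fun X => prime (g3 adj z) ∅ X) (polysOf W) X' := by
  rw [← corner_ratio_eq_sum_prod_Gk hzK hz0 hloc hK hKP, mul_div_cancel₀ _ (corner_empty_ne_zero hz0 hloc hKP)]

end Corner

end Literature.MathematicalPhysics.QuantumFieldTheory.BalabanImbrieJaffe1984to88.BIJ88Expansion5143Obs
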